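import Summits.BirchSwinnertonDyer.BirchSwinnertonDyer.Theorems.CyclotomicUntwistSwanConductorAtThree
import Literature.NumberTheory.EllipticCurves.TateModuleTwistTransportProofs
import Literature.NumberTheory.EllipticCurves.HasseWeilAbelianConductorProofs
import Literature.NumberTheory.EllipticCurves.InertiaInvariantsMultiplicativeProofs
import Literature.NumberTheory.EllipticCurves.TateModuleContinuityProofs
import Literature.NumberTheory.EllipticCurves.RootNumberProofs
import Literature.NumberTheory.EllipticCurves.RootNumberTwistProofs
import Literature.NumberTheory.EllipticCurves.LFunctionPrimeCoeff
import Literature.NumberTheory.EllipticCurves.QuadraticTwist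
import Literature.NumberTheory.DiophantineGeometry.ConductorAdditiveProofs
import Literature.NumberTheory.DiophantineGeometry.TateAlgorithmAdditiveProofs
import HarnessLib

/-!
# A curve with a SEMISTABLE quadratic twist at `3` is TAME at `3`: `δ₃ = 0`, `f₃ ≤ 2`; hence `27 ∣ N` forces EVERY quadratic twist to be
# additive at `3` (route `ManinLocalTwoThree`, crux C3 `ManinPrimeToThreeAtNine` stmt-BirchSwinnertonDyer-22968; cell bsd-f2-manin, p2 gen 15)

E-blind local law at the prime `3`, from the tree's Galois-side conductor theory: if some quadratic twist `W ⊗ ℚ(√d)` of the elliptic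
`W/ℚ` has good or multiplicative reduction at `3`, then the wild exponent `δ₃(W)` vanishes and `f₃(W) ≤ 2` (`= 2` when `W` is additive).
Proof (Silverman *ATAEC* IV.10.2(b), the twist argument): `I_𝔓` fixes a line of `V_ℓ(W ⊗ d)` (codimension `0` if good — Néron–Ogg–
Shafarevich, `codimFixed_inertia_rationalTate_eq_zero_of_hasGoodReductionAt` —, `1` if multiplicative,
`codimFixed_inertia_rationalTate_eq_one_of_hasMultiplicativeReductionAt_holds`), so `Sw_𝔓(V_ℓ W) = 0`
(`swanConductorAt_rationalTate_eq_zero_of_codimFixed_quadraticTwist_le_one`: `[ℚ(√d) : ℚ] ≤ 2` is prime to `3`, tame descent), and Ogg's formula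
at `3` — a THEOREM of the tree, `swanConductorAt_rationalTate_eq_wildConductorExponent_of_ringChar_eq_three_holds` — reads `δ₃(W) = Sw_𝔓 = 0`;
`f = ε + δ` with `ε ≤ 2`.  Consequences: `27 ∣ N(W)` (`f₃ ≥ 3`) ⟹ `W ⊗ ℚ(√d)` is ADDITIVE at `3` for every `d ≠ 0` — on the wild stratum the
«ternary twist additive» binder of this seat's C3 core (`maninPrimeToThreeAtNine_of_core`) is automatic, and no class with `27 ∣ N` is the
`χ_d`-twist of a `3`-semistable class (the twist-transport roads to C3 are void there by a LOCAL theorem, not only by census).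
HONEST FRAMING: local structure theorem assembled from the tree's conductor theory (Silverman *ATAEC* IV.10–11, in print); nothing about BSD,
Manin's conjecture or C3 is proved.  No definitions, no named facts, no sorry.
[cite: SilvermanATAEC1994, Thm. IV.10.2(a),(b) and proof (PDF pp. 358–362); Thm. IV.11.1 for p = 3 (PDF pp. 366–371)] [cite: SerreTate1968, §2.1]
-/

set_option autoImplicit false
-- lint-debt: the directory name repeats the summit name (sibling precedent `CyclotomicUntwistSwanConductorAtThree.lean`)
set_option linter.dupNamespace false

noncomputable section

open scoped NumberField
open WeierstrassCurve NumberField Field IsDedekindDomain IsDedekindDomain.HeightOneSpectrum Rat.HeightOneSpectrum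
  Literature.NumberTheory.GaloisRepresentations Literature.NumberTheory.EllipticCurves
  Literature.NumberTheory.DiophantineGeometry
  Summit.BirchSwinnertonDyer.Rank1Residual.Additive
  Summit.BirchSwinnertonDyer.BirchSwinnertonDyer.Theorems.SwanConductorAtThree

namespace Summit.BirchSwinnertonDyer.BirchSwinnertonDyer.Theorems.ManinLocalTwoThree

/-! ## §1 At the place of `𝓞 ℚ` above `3` -/

section RingOfIntegers

variable (W : WeierstrassCurve ℚ) [W.IsElliptic] {v : HeightOneSpectrum (𝓞 ℚ)}

/-- The place `primesEquiv.symm 3` of `𝓞 ℚ` contains `3`. [folklore] -/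
theorem three_mem_asIdeal_primesEquiv_symm_three :
    (3 : 𝓞 ℚ) ∈ ((primesEquiv (R := 𝓞 ℚ)).symm ⟨3, Nat.prime_three⟩).asIdeal := by
  set v : HeightOneSpectrum (𝓞 ℚ) := (primesEquiv (R := 𝓞 ℚ)).symm ⟨3, Nat.prime_three⟩ with hv
  have hgen : natGenerator v = 3 := congrArg Subtype.val ((primesEquiv (R := 𝓞 ℚ)).apply_symm_apply ⟨3, Nat.prime_three⟩)
  have h : ((natGenerator v : ℕ) : ℤ) ∈ v.asIdeal.map (Rat.IsIntegralClosure.intEquiv (𝓞 ℚ)) :=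
    (natGenerator_dvd_iff v).mp dvd_rfl
  rw [← map_natCast (Rat.IsIntegralClosure.intEquiv (𝓞 ℚ)) (natGenerator v), Ideal.apply_mem_of_equiv_iff, hgen] at h
  exact_mod_cast h

/-- **`δ_v(W) = 0` at `v ∋ 3` when a quadratic twist `W ⊗ ℚ(√d)` is semistable at `v` and `W` is additive there.**  Inertia fixes a line of
`V₂(W ⊗ d)` (Néron–Ogg–Shafarevich / Tate), so `Sw_𝔓(V₂ W) = 0` by tame descent along `ℚ(√d)`, and Ogg's formula at `3` gives `δ_v = Sw_𝔓`.
[cite: SilvermanATAEC1994, Thm. IV.10.2(a),(b) (PDF pp. 358–362) and Thm. IV.11.1, p = 3] -/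
theorem wildConductorExponent_eq_zero_of_isSemistableAt_quadraticTwist_of_three_mem (hv : (3 : 𝓞 ℚ) ∈ v.asIdeal)
    (hadd : W.HasAdditiveReductionAt v) {d : ℚ} (hd : d ≠ 0)
    (hsemi : (W.quadraticTwist d).HasGoodReductionAt v ∨ (W.quadraticTwist d).HasMultiplicativeReductionAt v) :
    W.wildConductorExponent v = 0 := by
  haveI : Fact (Nat.Prime 2) := ⟨Nat.prime_two⟩
  haveI := W.isElliptic_quadraticTwist hd
  have h := W.continuous_rationalGaloisRepTate_holds 2
  have h' := (W.quadraticTwist d).continuous_rationalGaloisRepTate_holds 2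
  obtain ⟨𝔓, h𝔓⟩ := v.primesAbove_nonempty
  have hℓv : ((2 : ℕ) : 𝓞 ℚ) ∉ v.asIdeal := two_notMem hv
  have h2 : ringChar (𝓞 ℚ ⧸ v.asIdeal) ≠ 2 := by rw [ringChar_eq_three hv]; decide
  -- inertia fixes a line of `V₂(W ⊗ d)`
  have hI : (rationalTateGaloisRepOf (geomPoints (W.quadraticTwist d)) 2 h').codimFixed (𝔓.inertia (absoluteGaloisGroup ℚ)) ≤ 1 := by
    rcases hsemi with hg | hm
    · exact ((W.quadraticTwist d).codimFixed_inertia_rationalTate_eq_zero_of_hasGoodReductionAt 2 h' hg hℓv h𝔓).le.trans zero_le_one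
    · exact ((W.quadraticTwist d).codimFixed_inertia_rationalTate_eq_one_of_hasMultiplicativeReductionAt_holds 2 h' v hℓv hm h𝔓).le
  -- `Sw_𝔓(V₂ W) = 0`, and Ogg at `3`: `Sw_𝔓 = δ_v`
  have hSw := W.swanConductorAt_rationalTate_eq_zero_of_codimFixed_quadraticTwist_le_one 2 h hℓv h2 h𝔓 hd h' hI
  rw [W.swanConductorAt_rationalTate_eq_wildConductorExponent_of_ringChar_eq_three_holds 2 h v hℓv hadd (ringChar_eq_three hv) h𝔓] at hSw
  exact_mod_cast hSw

/-- **`f_v(W) = 2` at `v ∋ 3` when `W` is additive at `v` with a quadratic twist semistable at `v`** (`f = ε + δ`, `ε = 2` additive, `δ = 0`).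
[cite: SilvermanATAEC1994, Thm. IV.10.2 and Thm. IV.11.1, p = 3] -/
theorem conductorExponent_eq_two_of_isSemistableAt_quadraticTwist_of_three_mem (hv : (3 : 𝓞 ℚ) ∈ v.asIdeal)
    (hadd : W.HasAdditiveReductionAt v) {d : ℚ} (hd : d ≠ 0)
    (hsemi : (W.quadraticTwist d).HasGoodReductionAt v ∨ (W.quadraticTwist d).HasMultiplicativeReductionAt v) :
    W.conductorExponent v = 2 := by
  haveI : PerfectField (IsLocalRing.ResidueField (v.adicCompletionIntegers ℚ)) := PerfectField.ofFinite
  have hδ := wildConductorExponent_eq_zero_of_isSemistableAt_quadraticTwist_of_three_mem W hv hadd hd hsemi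
  have hK : (W.kodairaSymbolAt v).IsAdditive := (W.isAdditive_kodairaSymbolAt_iff_holds v).mpr hadd
  have h2 : 2 ≤ W.conductorExponent v := (two_le_conductorExponent_iff_holds v W).mpr hadd
  rw [WeierstrassCurve.wildConductorExponent, tameConductorExponent_eq_two_of_isAdditive hK] at hδ
  omega

end RingOfIntegers

/-! ## §2 At the place `placeOf 3` of `ℤ` -/

section IntPlace

variable (W : WeierstrassCurve ℚ) [W.IsElliptic]

/-- **`f₃(W) = 2` when `W` is additive at `3` with a quadratic twist semistable at `3`** (at `placeOf 3`, the cell's currency `condExp W 3`).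
[cite: SilvermanATAEC1994, Thm. IV.10.2 and Thm. IV.11.1, p = 3] -/
theorem conductorExponent_placeOf_three_eq_two_of_isSemistableAt_quadraticTwist
    (hadd : W.HasAdditiveReductionAt (placeOf 3)) {d : ℚ} (hd : d ≠ 0)
    (hsemi : (haveI := W.isElliptic_quadraticTwist hd; (W.quadraticTwist d).HasGoodReductionAt (placeOf 3)) ∨
      (W.quadraticTwist d).HasMultiplicativeReductionAt (placeOf 3)) :
    W.conductorExponent (placeOf 3) = 2 := by
  haveI := W.isElliptic_quadraticTwist hd
  set w : HeightOneSpectrum (𝓞 ℚ) := (primesEquiv (R := 𝓞 ℚ)).symm ⟨3, Nat.prime_three⟩ with hw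
  have hw3 : (3 : 𝓞 ℚ) ∈ w.asIdeal := three_mem_asIdeal_primesEquiv_symm_three
  have hpw : primesEquiv w = ⟨3, Nat.prime_three⟩ := (primesEquiv (R := 𝓞 ℚ)).apply_symm_apply _
  -- transport the reduction data to `w`
  have haddw : W.HasAdditiveReductionAt w := by
    rw [hw, ← W.hasAdditiveReductionAt_int_iff_ringOfIntegers ⟨3, Nat.prime_three⟩]; exact hadd
  have hsemiw : (W.quadraticTwist d).HasGoodReductionAt w ∨ (W.quadraticTwist d).HasMultiplicativeReductionAt w := by
    rcases hsemi with hg | hm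
    · left
      have h1 := ((W.quadraticTwist d).hasGoodReductionAtPrime_iff_hasGoodReductionAt_holds ⟨3, Nat.prime_three⟩).mpr hg
      have h2 := (hasGoodReductionAtPrime_iff_hasGoodReductionAt_ringOfIntegers w (W.quadraticTwist d))
      rw [hpw] at h2
      exact h2.mp h1
    · right
      have h1 := ((W.quadraticTwist d).hasMultiplicativeReductionAtPrime_iff_hasMultiplicativeReductionAt_holds ⟨3, Nat.prime_three⟩).mpr hm
      have h2 := ((W.quadraticTwist d).hasMultiplicativeReductionAtPrime_iff_hasMultiplicativeReductionAt_ringOfIntegers w)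
      rw [hpw] at h2
      exact h2.mp h1
  have hf := conductorExponent_eq_two_of_isSemistableAt_quadraticTwist_of_three_mem W hw3 haddw hd hsemiw
  rwa [conductorExponent_eq_condExp_three W hw3] at hf

/-- **`27 ∣ N(W)` ⟹ EVERY quadratic twist `W ⊗ ℚ(√d)` is ADDITIVE at `3`** (wild ramification at `3` is not killed by a quadratic —
tamely ramified — twist): `f₃(W) ≥ 3 > 2`. In particular no class with `27 ∣ N` is a quadratic twist of a class semistable at `3`.
[cite: SilvermanATAEC1994, Thm. IV.10.2 and Thm. IV.11.1, p = 3] -/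
theorem hasAdditiveReductionAt_quadraticTwist_placeOf_three_of_twentyseven_dvd (h27 : 3 ^ 3 ∣ W.conductorNorm ℤ) {d : ℚ} (hd : d ≠ 0) :
    (haveI := W.isElliptic_quadraticTwist hd; (W.quadraticTwist d).HasAdditiveReductionAt (placeOf 3)) := by
  haveI := W.isElliptic_quadraticTwist hd
  haveI : PerfectField (IsLocalRing.ResidueField ((placeOf 3).adicCompletionIntegers ℚ)) := PerfectField.ofFinite
  have hfac : (W.conductorNorm ℤ).factorization 3 = W.conductorExponent (placeOf 3) :=
    factorization_conductorNorm_primesEquiv_symm W ⟨3, Nat.prime_three⟩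
  have h3f : 3 ≤ W.conductorExponent (placeOf 3) := by
    rw [← hfac]; exact (Nat.prime_three.pow_dvd_iff_le_factorization (W.conductorNorm_pos_holds).ne').mp h27
  have hadd : W.HasAdditiveReductionAt (placeOf 3) := (two_le_conductorExponent_iff_holds (placeOf 3) W).mp (by omega)
  rcases hasGoodReductionAt_or_hasMultiplicativeReductionAt_or_hasAdditiveReductionAt (placeOf 3) (W.quadraticTwist d) with hg | hm | ha
  · have := conductorExponent_placeOf_three_eq_two_of_isSemistableAt_quadraticTwist W hadd hd (Or.inl hg); omega
  · have := conductorExponent_placeOf_three_eq_two_of_isSemistableAt_quadraticTwist W hadd hd (Or.inr hm); omega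
  · exact ha

/-- **`27 ∣ N(W)` ⟹ `9 ∣ N(W ⊗ ℚ(√d))`** for every `d ≠ 0` (the twist is additive at `3`; conductor-norm currency).
[cite: SilvermanATAEC1994, Thm. IV.10.2 and Thm. IV.11.1, p = 3] -/
theorem nine_dvd_conductorNorm_quadraticTwist_of_twentyseven_dvd (h27 : 3 ^ 3 ∣ W.conductorNorm ℤ) {d : ℚ} (hd : d ≠ 0) :
    (haveI := W.isElliptic_quadraticTwist hd; 3 ^ 2 ∣ (W.quadraticTwist d).conductorNorm ℤ) := by
  haveI := W.isElliptic_quadraticTwist hd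
  haveI : PerfectField (IsLocalRing.ResidueField ((placeOf 3).adicCompletionIntegers ℚ)) := PerfectField.ofFinite
  have hadd := hasAdditiveReductionAt_quadraticTwist_placeOf_three_of_twentyseven_dvd W h27 hd
  have h2 : 2 ≤ (W.quadraticTwist d).conductorExponent (placeOf 3) := (two_le_conductorExponent_iff_holds (placeOf 3) _).mpr hadd
  rw [(Nat.prime_three.pow_dvd_iff_le_factorization ((W.quadraticTwist d).conductorNorm_pos_holds).ne'),
    factorization_conductorNorm_primesEquiv_symm (W.quadraticTwist d) ⟨3, Nat.prime_three⟩]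
  exact h2

end IntPlace

end Summit.BirchSwinnertonDyer.BirchSwinnertonDyer.Theorems.ManinLocalTwoThree

end
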